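import Summits.QuantumFields.YangMills.Theorems.UnitScaleTiltProp7HSplitDOfRows
import Summits.QuantumFields.YangMills.Theorems.UnitScaleTiltProp7NestedMeanParallelLift
import Summits.QuantumFields.YangMills.Theorems.UnitScaleTiltProp7NestedMeanTowerClosenessPlug
import HarnessLib

/-!
# Route `UnitScaleTilt`, crux K1 child «MinimiserStabilityRegPr» (stmt-QuantumFields-19200), skeleton v10, stub `stub_existenceMinimalOrbit` (EX), route (α) —
# **THE EX DISPLAY'S ROW `hSplit′`∕`hSplitD` FROM THREE CURRENCY ROWS + THE SECTOR RESIDUE `hLift`** (the SECTOR HALF of the (P2)-KNIT: ✓`Prop7HSplitDOfRows.hSplitD_of_rows` (★w4 g8,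
# ✓p665110: five rows + window) AT THE SECTOR OF RECORD `Z := «∃ ns, ns 0 = l₁ ∧ hsucc ∧ ns (K − n) = 0»` (✓p663081 §5, ★px20) and `P₂ := 2`, with (Poincaré) DISCHARGED by ★px11's
# ✓`Prop7NestedMeanTowerCloseness.hPoinc_of_regPr` (ROW-B ✓p663081 ∘ ROW-T ✓p663237∕✓p664831, from `RegPr` + `10⁷L³ε₀ ≤ 1` alone) and (H-Z) DISCHARGED by ★px20's
# ✓`Prop7NestedMeanParallelLift.hHZ_of_parallelLift` modulo its ONE displayed hypothesis `hLift` «every `Ū₀`-parallel coarse section lifts to a `U₀`-parallel fine section» (★px10 v2 §3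
# exit (ii), the sector decision's residue) — so that the remaining (P2)-KNIT-Y1 (★w5-20520 g7) is the CURRENCY HALF only: instantiate `(Y, Kop, q)` at (Y1) and feed (T) `hT`, (Q4-H²)
# `hQ4`, (T-small) `hKT`.

Cell `ym3-torus`, width seat `ym-ust-20520-w4` (gen 8).  THEOREMS ONLY (0 `def`, 0 `sorry`).  `--supports stmt-QuantumFields-19200 --as helper`, count-neutral.  YM₃ on T³ is a ladder rung
(R3), not the Clay problem; nothing here claims the stub, the crux, d = 4 or the mass gap.

WHAT IS PROVED (member `F`, `h : n ≤ K`; sorry-free, no definition; ns `…Theorems.Prop7HSplitDOfThreeRows`):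
* §0 `regPr_chartPoint`, `coe_chartPoint`, `norm_chartPoint_lt` — the three chart-point facts the (T)-row supplier (★px10 FILE 1b `fderiv_logChartTwS_eq_zero_of_frameCorrected_eq_zero`)
  wants as antecedents at KNIT-Y1: `emb15 U₀ (expHermField X) ∈ 𝔘_k(178(ε₀ + e))` (✓`in19_expHermField_of_nMax19_lt` ∘ ✓`regPr_emb15_of_in19`, as inside
  ✓`Prop7FibreELOfCritSplit.fibreEL_of_crit_split`), `(emb15 U₀ (expHermField X))(b) = e^{χ(A′)(b)}·U₀(b)` (✓`coe_emb15_expHermField`), `‖χ(A′)‖ < e·η` (✓`chartPoint_su2_norm`).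
* §1 ★★`htest_at_chart_of_threeRows` — the complex pairing test at the chart (the `htest` slot of ✓`hSplitD_of_pairing`) from (T) `hT`, (Q4-H²) `hQ4`, (T-small on the sector `Z`) `hKT` over an
  abstract coarse currency `{Y} [AddCommGroup Y] Kop q hKsub`, constants `C₀ δ ≥ 0`, the residue `hLift`, and the window `2(56e)(2 + C₀δ·(2·2)) + C₀δ·(2·2) < 1`.
* §2 ★★★`hSplitD_of_threeRows` — the `hSplitD` hypothesis of ✓`Prop7FibreELOfCritSplitD.fibreEL_of_crit_splitD` VERBATIM (at `Sl δ := (Q(U₀)δ = 0 ∧ IsLandauPrintS U₀ δ)`,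
  `U′ := emb15 U₀ (expHermField X)`) from the same data.
INHABITABILITY (★★OWNER RULING g27-№9 (3)): NO new displayed row — `hT`, `hQ4`, `hKT`, the window are ✓`htest_of_rows`' binders (its inhabitability line: `Kop := 0`, `q := 0`, `C₀ = δ = 0`,
window `224e < 1`); `hLift` is ✓`hHZ_of_parallelLift`'s binder verbatim (inhabited at `U₀ = 1`, abelian `U₀`, irreducible `Ū₀`; fails exactly on ★px10 v2 §3's stratum (c) — the planner's
sector decision).
HONEST SCOPE.  A composition of landed theorems; the three rows and `hLift` are HYPOTHESES (suppliers: ROW-G ★px10 FILE 1b ∘ ROW-V ★px6; ★w5 FILE 3 `hQ4_of_rows` ∘ ★px10 FILE 2 ∘ ★px6 `hK`;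
★px6 B2; the planner); nothing of EX, the crux, N06(d = 3) or the gap is proved or claimed.

References: T. Bałaban, CMP 99 (1985) 389–434 [Balaban1985BackgroundPropagators] ((3.3) p.391, (3.13)–(3.15) p.393, (3.19)–(3.23) pp.393–394, (3.115) p.418); CMP 102 (1985) 277–309
[Balaban1985Variational] ((19) p.281, (44)–(51) pp.285–286, (82)–(83) p.290, (112) p.294); CMP 98 (1985) 17–51 [Balaban1985Averaging] ((8)–(11) pp.18–19, (32)–(34) pp.22–23, (97) p.32);
CMP 99 (1985) 75–102 [Balaban1985RegularSpaces] (Sect. D pp.89–95, Prop. 7 p.98).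
-/

set_option autoImplicit false

noncomputable section

open scoped InnerProductSpace Matrix.Norms.L2Operator Matrix BigOperators
open Filter Metric NormedSpace

namespace Summit.QuantumFields.YangMills.Theorems.Prop7HSplitDOfThreeRows

open Literature.Analysis.Calculus.ExpDifferential (ad gSer)
open Literature.MathematicalPhysics.QuantumFieldTheory.Balaban1983to89
open Literature.MathematicalPhysics.QuantumFieldTheory.Balaban1983to89.T3ContinuumYM3Torus
open T4Continuum BlockAveraging
open BlockAveraging (Idx)
open B7Prop1Explicit (U1 treeWord disp)
open B10Eq27TorusAxialLog (holT transl unitsField toUField)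
open B7TransferAnalyticMean (meanCLM)
open B15DeterminingSets (embIter)
open T3PrintedRegularMinimiser (RegPr)
open T3SectALandauChart (In19 emb15 eta eta_pos bgUnits)
open B11Prop3Model (Dfix)
open B11Eq103H1Complex (SiteL2K BondL2K)
open Summit.QuantumFields.YangMills.Theorems.Prop8Chart (emlIterU)
open Summit.QuantumFields.YangMills.Theorems.Prop7SectET3Transport (periodsT3)
open Summit.QuantumFields.YangMills.Theorems.Prop7SymAvgTwSym (logChartTwS QTwS CmapTwS Chart47T3twS)
open Summit.QuantumFields.YangMills.Theorems.Prop7SymAvgGL (QSym)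
open Summit.QuantumFields.YangMills.Theorems.Prop7SectET3HilbertLetters (W₂ toL2 toL2S DL2 DstarL2 covLapSite)
open Summit.QuantumFields.YangMills.Theorems.Prop7SectET3GaugeProjector (NS)
open Summit.QuantumFields.YangMills.Theorems.Prop7SPrint (IsLandauPrintS)
open Summit.QuantumFields.YangMills.Theorems.Prop7TPrint (nMax19 expHermField)
open Summit.QuantumFields.YangMills.Theorems.Prop7LandauTransversalityMarginSU2Chart (chartPoint_su2_norm)
open Summit.QuantumFields.YangMills.Theorems.Prop7HSplitDOfRows (htest_at_chart_of_rows hSplitD_of_rows)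
open Summit.QuantumFields.YangMills.Theorems.Prop7NestedMeanParallelLift (hHZ_of_parallelLift)
open Summit.QuantumFields.YangMills.Theorems.Prop7NestedMeanTowerCloseness (hPoinc_of_regPr)
open Summit.QuantumFields.YangMills.Theorems.Prop7FibreELOfCritSplit (coe_emb15_expHermField)
open Summit.QuantumFields.YangMills.Theorems.Prop7B8Prop7Div (regPr_emb15_of_in19)
open Summit.QuantumFields.YangMills.Theorems.Prop7PV3CDELogChart (in19_expHermField_of_nMax19_lt)

variable (F : T3Family) {n K : ℕ} (h : n ≤ K)

/-! ## §0 The chart point: printed regularity and bond values (antecedents of the (T)-row supplier at KNIT-Y1) -/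

/-- **THE CHART POINT IS PRINTED-REGULAR OF RADIUS `178(ε₀ + e)`**: for `U₀ ∈ 𝔘_k(ε₀)`, `X` Hermitian traceless of (19)-size `nMax19 U₀ X < e` and the windows `10⁹L²e ≤ 1`, `10¹²L³ε₀ ≤ 1`,
`emb15 U₀ (expHermField X) ∈ 𝔘_k(178(ε₀ + e))` ([Balaban1985RegularSpaces] Prop. 7 through (19): ✓`in19_expHermField_of_nMax19_lt` ∘ ✓`regPr_emb15_of_in19`, the two lines inside
✓`Prop7FibreELOfCritSplit.fibreEL_of_crit_split`). [cite: Balaban1985RegularSpaces, Prop. 7 p.98; Balaban1985Variational, (19) p.281, (112) p.294] -/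
theorem regPr_chartPoint {ε₀ e : ℝ} (hε₀ : 0 < ε₀) (he : 0 < e) (hWe : 10 ^ 9 * (F.L : ℝ) ^ 2 * e ≤ 1) (hWε : 10 ^ 12 * (F.L : ℝ) ^ 3 * ε₀ ≤ 1)
    (U₀ : GaugeField (F.P K) 0 (Matrix.specialUnitaryGroup (Fin 2) ℂ)) (hreg : RegPr F n K ε₀ U₀)
    {X : PBond (F.P K) 0 → Matrix (Fin 2) (Fin 2) ℂ} (hX : ∀ b, (X b).IsHermitian ∧ (X b).trace = 0) (hsize : nMax19 F n K U₀ X < e) :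
    RegPr F n K (178 * (ε₀ + e)) (emb15 U₀ (expHermField X)) := by
  have hL1 : (1 : ℝ) ≤ (F.L : ℝ) := by exact_mod_cast F.hL.2.le
  have hL2 : (1 : ℝ) ≤ (F.L : ℝ) ^ 2 := one_le_pow₀ hL1
  have hL3 : (1 : ℝ) ≤ (F.L : ℝ) ^ 3 := one_le_pow₀ hL1
  have hε₂ : ε₀ + e ≤ 1 / 4 := by nlinarith
  have h19 : In19 F n K (ε₀ + e) U₀ (expHermField X) X := in19_expHermField_of_nMax19_lt hX (hsize.trans_le (by linarith))
  exact regPr_emb15_of_in19 F n K hε₂ (by linarith) hreg h19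

/-- **THE BOND VALUES OF THE CHART POINT**: `χ(A′) = iX` ⟹ `(emb15 U₀ (expHermField X))(b) = e^{χ(A′)(b)}·U₀(b)` (✓`coe_emb15_expHermField`).
[cite: Balaban1985Variational, (15) p.280, (112) p.294] -/
theorem coe_chartPoint (U₀ : GaugeField (F.P K) 0 (Matrix.specialUnitaryGroup (Fin 2) ℂ))
    {A₁ X : PBond (F.P K) 0 → Matrix (Fin 2) (Fin 2) ℂ} (hX : ∀ b, (X b).IsHermitian ∧ (X b).trace = 0) (hAX : A₁ = fun b' => Complex.I • X b') (b : PBond (F.P K) 0) :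
    ((emb15 U₀ (expHermField X) b : Matrix.specialUnitaryGroup (Fin 2) ℂ) : Matrix (Fin 2) (Fin 2) ℂ) =
      exp (A₁ b) * ((U₀ b : Matrix.specialUnitaryGroup (Fin 2) ℂ) : Matrix (Fin 2) (Fin 2) ℂ) := by
  rw [coe_emb15_expHermField F U₀ hX b, hAX]

/-- **THE CHART POINT LIES IN THE `eη`-BALL**: `‖χ(A′)‖ < e·η` for `A′` in the half ball `2‖A′‖ < ε` (= ✓`Prop7LandauTransversalityMarginSU2Chart.chartPoint_su2_norm … |>.1`, named here
for the (T)-row supplier's antecedent `hA₁ : ‖A₁‖ < e·η`). [cite: Balaban1985Variational, (47)–(51) pp.285–286, Prop. 3 p.289] -/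
theorem norm_chartPoint_lt [Fact (0 < (F.L : ℝ))] [Fact (0 < ((F.L : ℝ)⁻¹) ^ (K - n))]
    {ε₀ e b ε : ℝ} (hε₀ : 0 < ε₀) (he : 0 < e) (hWe : 10 ^ 9 * (F.L : ℝ) ^ 2 * e ≤ 1) (hWε : 10 ^ 12 * (F.L : ℝ) ^ 3 * ε₀ ≤ 1)
    (U₀ : GaugeField (F.P K) 0 (Matrix.specialUnitaryGroup (Fin 2) ℂ)) (hreg : RegPr F n K ε₀ U₀)
    {H : (PBond (F.P n) 0 → Matrix (Fin 2) (Fin 2) ℂ) →ₗ[ℂ] (PBond (F.P K) 0 → Matrix (Fin 2) (Fin 2) ℂ)} (hb : 0 ≤ b) (hHop : ∀ Y, ‖H Y‖ ≤ b * ‖Y‖)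
    (hHR : ∀ Y : PBond (F.P n) 0 → Matrix (Fin 2) (Fin 2) ℂ, (∀ c, star (Y c) = -Y c ∧ (Y c).trace = 0) → ∀ b', star (H Y b') = -H Y b' ∧ (H Y b').trace = 0)
    (hq : 9 * (40 * (2 * (3 * (2 * e + 2700 * (F.L : ℝ) * ε₀))) / (e * eta F n K) ^ 2) * b * ε < 1) (hRε : 6 * ε ≤ e * eta F n K)
    (h47 : Chart47T3twS F n K h (40 * (2 * (3 * (2 * e + 2700 * (F.L : ℝ) * ε₀))) / (e * eta F n K) ^ 2) ε U₀ H)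
    {A' : PBond (F.P K) 0 → Matrix (Fin 2) (Fin 2) ℂ} (hA' : 2 * ‖A'‖ < ε) (hA'R : ∀ b', star (A' b') = -A' b' ∧ (A' b').trace = 0) :
    ‖A' - H (Dfix (CmapTwS F n K h U₀) H (40 * (2 * (3 * (2 * e + 2700 * (F.L : ℝ) * ε₀))) / (e * eta F n K) ^ 2) A')‖ < e * eta F n K := by
  have hA'1 : ‖A'‖ < ε := by linarith [norm_nonneg A']
  exact (chartPoint_su2_norm F h hε₀ he hWe hWε U₀ hreg hb hHop hHR hq hRε h47 hA'1 hA'R).1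

/-! ## §1 The complex pairing test at the chart from three currency rows + `hLift` -/

/-- ★★ **THE COMPLEX PAIRING TEST AT THE CHART POINT FROM THREE CURRENCY ROWS AND THE SECTOR RESIDUE `hLift`** — ✓`Prop7HSplitDOfRows.htest_at_chart_of_rows` at the sector of record
`Z l₁ := ∃ ns, ns 0 = l₁ ∧ hsucc ∧ ns (K − n) = 0` and `P₂ := 2`, (Poincaré) := ✓`hPoinc_of_regPr` (★px11), (H-Z) := ✓`hHZ_of_parallelLift … hLift` (★px20).  Displayed: (T) `hT`, (Q4-H²)
`hQ4`, (T-small on `Z`) `hKT` at the chart letters `M b := g(ad(−χ(A′)(b)))`, `Gd N(b) := N(b₋) − e^{χ(A′)(b)}(U₀(b)N(b₊)U₀(b)⋆)e^{−χ(A′)(b)}`, `T := D(log U̿^{twS})(χ(A′))`; `hLift`; the window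
`2(56e)(2 + C₀δ(2·2)) + C₀δ(2·2) < 1`.  Conclusion = the `htest` slot of ✓`hSplitD_of_pairing` VERBATIM.
[cite: Balaban1985BackgroundPropagators, (3.3) p.391, (3.19)–(3.23) pp.393–394, (3.115) p.418; Balaban1985Variational, (19) p.281, (45) p.285, (47)–(51) pp.285–286; Balaban1985Averaging, (8)–(11) pp.18–19, (97) p.32] -/
theorem htest_at_chart_of_threeRows [Fact (0 < (F.L : ℝ))] [Fact (0 < ((F.L : ℝ)⁻¹) ^ (K - n))] {c₀ cB : ℝ} [Fact (0 < c₀)] [Fact (0 < cB)]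
    {ε₀ e b ε : ℝ} (hε₀ : 0 < ε₀) (he : 0 < e) (hWe : 10 ^ 9 * (F.L : ℝ) ^ 2 * e ≤ 1) (hWε : 10 ^ 12 * (F.L : ℝ) ^ 3 * ε₀ ≤ 1)
    (U₀ : GaugeField (F.P K) 0 (Matrix.specialUnitaryGroup (Fin 2) ℂ)) (hreg : RegPr F n K ε₀ U₀)
    {H : (PBond (F.P n) 0 → Matrix (Fin 2) (Fin 2) ℂ) →ₗ[ℂ] (PBond (F.P K) 0 → Matrix (Fin 2) (Fin 2) ℂ)} (hb : 0 ≤ b) (hHop : ∀ Y, ‖H Y‖ ≤ b * ‖Y‖)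
    (hHR : ∀ Y : PBond (F.P n) 0 → Matrix (Fin 2) (Fin 2) ℂ, (∀ c, star (Y c) = -Y c ∧ (Y c).trace = 0) → ∀ b', star (H Y b') = -H Y b' ∧ (H Y b').trace = 0)
    (hq : 9 * (40 * (2 * (3 * (2 * e + 2700 * (F.L : ℝ) * ε₀))) / (e * eta F n K) ^ 2) * b * ε < 1) (hRε : 6 * ε ≤ e * eta F n K)
    (h47 : Chart47T3twS F n K h (40 * (2 * (3 * (2 * e + 2700 * (F.L : ℝ) * ε₀))) / (e * eta F n K) ^ 2) ε U₀ H)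
    {A' : PBond (F.P K) 0 → Matrix (Fin 2) (Fin 2) ℂ} (hA' : 2 * ‖A'‖ < ε) (hA'R : ∀ b', star (A' b') = -A' b' ∧ (A' b').trace = 0)
    {X : PBond (F.P K) 0 → Matrix (Fin 2) (Fin 2) ℂ}
    (hAX : A' - H (Dfix (CmapTwS F n K h U₀) H (40 * (2 * (3 * (2 * e + 2700 * (F.L : ℝ) * ε₀))) / (e * eta F n K) ^ 2) A') = fun b' => Complex.I • X b')
    (hsize : nMax19 F n K U₀ X < e)
    -- the sector residue (★px10 v2 §3 exit (ii); ✓`hHZ_of_parallelLift`'s binder verbatim)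
    (hLift : ∀ cf : Site (F.P K) (K - n) → Matrix (Fin 2) (Fin 2) ℂ,
      (∀ e' : PBond (F.P K) (K - n), cf e'.src = ((emlIterU (K - n) (bgUnits F K U₀) e' : (Matrix (Fin 2) (Fin 2) ℂ)ˣ) : Matrix (Fin 2) (Fin 2) ℂ) * cf e'.tgt *
        (((emlIterU (K - n) (bgUnits F K U₀) e')⁻¹ : (Matrix (Fin 2) (Fin 2) ℂ)ˣ) : Matrix (Fin 2) (Fin 2) ℂ)) →
      ∃ l₀ : Site (F.P K) 0 → Matrix (Fin 2) (Fin 2) ℂ,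
        (∀ b' : PBond (F.P K) 0, l₀ b'.src = ((bgUnits F K U₀ b' : (Matrix (Fin 2) (Fin 2) ℂ)ˣ) : Matrix (Fin 2) (Fin 2) ℂ) * l₀ b'.tgt * (((bgUnits F K U₀ b')⁻¹ : (Matrix (Fin 2) (Fin 2) ℂ)ˣ) : Matrix (Fin 2) (Fin 2) ℂ)) ∧
        ∀ y : Site (F.P K) (K - n), l₀ (embIter (K - n) y) = cf y)
    -- the coarse currency and the three rows
    {Y : Type*} [AddCommGroup Y] (Kop : (Site (F.P K) 0 → Matrix (Fin 2) (Fin 2) ℂ) → Y) (q : Y → ℝ)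
    (hKsub : ∀ a b : Site (F.P K) 0 → Matrix (Fin 2) (Fin 2) ℂ, Kop (a - b) = Kop a - Kop b)
    {C₀ δ : ℝ} (hC₀ : 0 ≤ C₀) (hδ : 0 ≤ δ)
    (hwin : 2 * (56 * e) * (2 + C₀ * δ * (2 * 2)) + C₀ * δ * (2 * 2) < 1)
    (hT : ∀ (N' : Site (F.P K) 0 → Matrix (Fin 2) (Fin 2) ℂ) (w : PBond (F.P K) 0 → Matrix (Fin 2) (Fin 2) ℂ),
      (∀ b, gSer ℂ (ad ℂ (-(A' - H (Dfix (CmapTwS F n K h U₀) H (40 * (2 * (3 * (2 * e + 2700 * (F.L : ℝ) * ε₀))) / (e * eta F n K) ^ 2) A')) b)) (w b) =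
        N' b.src - exp ((A' - H (Dfix (CmapTwS F n K h U₀) H (40 * (2 * (3 * (2 * e + 2700 * (F.L : ℝ) * ε₀))) / (e * eta F n K) ^ 2) A')) b) * (((U₀ b : Matrix.specialUnitaryGroup (Fin 2) ℂ) : Matrix (Fin 2) (Fin 2) ℂ) * N' b.tgt
          * star ((U₀ b : Matrix.specialUnitaryGroup (Fin 2) ℂ) : Matrix (Fin 2) (Fin 2) ℂ)) * exp (-(A' - H (Dfix (CmapTwS F n K h U₀) H (40 * (2 * (3 * (2 * e + 2700 * (F.L : ℝ) * ε₀))) / (e * eta F n K) ^ 2) A')) b)) →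
      Kop N' = 0 → fderiv ℂ (logChartTwS F n K h U₀) (A' - H (Dfix (CmapTwS F n K h U₀) H (40 * (2 * (3 * (2 * e + 2700 * (F.L : ℝ) * ε₀))) / (e * eta F n K) ^ 2) A')) w = 0)
    (hQ4 : ∀ m : Y, ∃ N : Site (F.P K) 0 → Matrix (Fin 2) (Fin 2) ℂ, Kop N = m ∧ ‖toL2S F K c₀ N‖ ≤ C₀ * q m ∧
      ‖DL2 F n K c₀ U₀ (toL2S F K c₀ N)‖ ≤ C₀ * q m ∧ ‖covLapSite F n K c₀ U₀ (toL2S F K c₀ N)‖ ≤ C₀ * q m)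
    (hKT : ∀ l₁ : Site (F.P K) 0 → Matrix (Fin 2) (Fin 2) ℂ, toL2S F K c₀ l₁ ∈ NS F n K h c₀ cB U₀ →
      (∃ ns : (j : ℕ) → Site (F.P K) j → Matrix (Fin 2) (Fin 2) ℂ, ns 0 = l₁ ∧
        (∀ (j : ℕ) (y : Site (F.P K) (j + 1)), ns (j + 1) y = ns j (emb y) - meanCLM (Idx (F.P K)) (Matrix (Fin 2) (Fin 2) ℂ) fun i : Idx (F.P K) =>
          ns j (emb y) - ((holT (emlIterU j (bgUnits F K U₀)) (emb y) (stairWord i.2.1 (off i.1)) : (Matrix (Fin 2) (Fin 2) ℂ)ˣ) : Matrix (Fin 2) (Fin 2) ℂ) *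
            ns j (transl (emb y) (disp (stairWord i.2.1 (off i.1)))) * (((holT (emlIterU j (bgUnits F K U₀)) (emb y) (stairWord i.2.1 (off i.1)))⁻¹ : (Matrix (Fin 2) (Fin 2) ℂ)ˣ) : Matrix (Fin 2) (Fin 2) ℂ)) ∧
        ∀ y, ns (K - n) y = 0) →
      q (Kop l₁) ≤ δ * (‖toL2S F K c₀ l₁‖ + ‖DL2 F n K c₀ U₀ (toL2S F K c₀ l₁)‖)) :
    ∀ l : Site (F.P K) 0 → Matrix (Fin 2) (Fin 2) ℂ, toL2S F K c₀ l ∈ NS F n K h c₀ cB U₀ →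
      covLapSite F n K c₀ U₀ (toL2S F K c₀ l) ≠ 0 →
      ∃ (N'' : Site (F.P K) 0 → Matrix (Fin 2) (Fin 2) ℂ) (w : PBond (F.P K) 0 → Matrix (Fin 2) (Fin 2) ℂ),
        (∀ b, gSer ℂ (ad ℂ (-(A' - H (Dfix (CmapTwS F n K h U₀) H (40 * (2 * (3 * (2 * e + 2700 * (F.L : ℝ) * ε₀))) / (e * eta F n K) ^ 2) A')) b)) (w b) =
          N'' b.src - exp ((A' - H (Dfix (CmapTwS F n K h U₀) H (40 * (2 * (3 * (2 * e + 2700 * (F.L : ℝ) * ε₀))) / (e * eta F n K) ^ 2) A')) b) * (((U₀ b : Matrix.specialUnitaryGroup (Fin 2) ℂ) : Matrix (Fin 2) (Fin 2) ℂ) * N'' b.tgt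
            * star ((U₀ b : Matrix.specialUnitaryGroup (Fin 2) ℂ) : Matrix (Fin 2) (Fin 2) ℂ)) * exp (-(A' - H (Dfix (CmapTwS F n K h U₀) H (40 * (2 * (3 * (2 * e + 2700 * (F.L : ℝ) * ε₀))) / (e * eta F n K) ^ 2) A')) b)) ∧
        fderiv ℂ (logChartTwS F n K h U₀) (A' - H (Dfix (CmapTwS F n K h U₀) H (40 * (2 * (3 * (2 * e + 2700 * (F.L : ℝ) * ε₀))) / (e * eta F n K) ^ 2) A')) w = 0 ∧
        ⟪toL2 F K c₀ w, DL2 F n K c₀ U₀ (covLapSite F n K c₀ U₀ (toL2S F K c₀ l))⟫_ℂ ≠ 0 := by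
  have hL1 : (1 : ℝ) ≤ (F.L : ℝ) := by exact_mod_cast F.hL.2.le
  have hL3 : (1 : ℝ) ≤ (F.L : ℝ) ^ 3 := one_le_pow₀ hL1
  have hε7 : 10 ^ 7 * (F.L : ℝ) ^ 3 * ε₀ ≤ 1 := by nlinarith
  have h1 : (1 : ℝ) ≤ 2 := by norm_num
  exact htest_at_chart_of_rows F h hε₀ he hWe hWε U₀ hreg hb hHop hHR hq hRε h47 hA' hA'R hAX hsize _ Kop q hKsub (P₂ := 2) hC₀ hδ h1 hwin hT hQ4 hKT
    (hPoinc_of_regPr F h cB hε₀ hε7 U₀ hreg) (hHZ_of_parallelLift F h hε₀ hWε U₀ hreg hLift)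

/-! ## §2 `hSplitD` from three currency rows + `hLift` -/

/-- ★★★ **`hSplitD` FROM THREE CURRENCY ROWS AND THE SECTOR RESIDUE `hLift`** — the `hSplitD` hypothesis of ✓`Prop7FibreELOfCritSplitD.fibreEL_of_crit_splitD` VERBATIM (at `Sl δ := (Q(U₀)δ = 0 ∧
IsLandauPrintS U₀ δ)`, `U′ := emb15 U₀ (expHermField X)`): ✓`Prop7HSplitDOfRows.hSplitD_of_rows` at `Z := «∃ ns, ns 0 = l₁ ∧ hsucc ∧ ns (K − n) = 0»`, `P₂ := 2`, (Poincaré) :=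
✓`hPoinc_of_regPr` (★px11), (H-Z) := ✓`hHZ_of_parallelLift … hLift` (★px20); displayed: (T) `hT`, (Q4-H²) `hQ4`, (T-small on `Z`) `hKT` over an abstract coarse currency, `hLift`, and the window
`2(56e)(2 + C₀δ(2·2)) + C₀δ(2·2) < 1`.
[cite: Balaban1985Variational, (19) p.281, (44)–(51) pp.285–286, (82)–(83) p.290, Prop. 3 p.289, (112) p.294; Balaban1985BackgroundPropagators, (3.3) p.391, (3.13)–(3.15) p.393, (3.19)–(3.23) pp.393–394, (3.115) p.418; Balaban1985Averaging, (8)–(11) pp.18–19, (32)–(34) pp.22–23, (97) p.32; Balaban1985RegularSpaces, Sect. D pp.89–95, Prop. 7 p.98] -/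
theorem hSplitD_of_threeRows [Fact (0 < (F.L : ℝ))] [Fact (0 < ((F.L : ℝ)⁻¹) ^ (K - n))] {c₀ cB : ℝ} [Fact (0 < c₀)] [Fact (0 < cB)]
    {ε₀ e b ε : ℝ} (hε₀ : 0 < ε₀) (he : 0 < e) (hWe : 10 ^ 9 * (F.L : ℝ) ^ 2 * e ≤ 1) (hWε : 10 ^ 12 * (F.L : ℝ) ^ 3 * ε₀ ≤ 1)
    (hw137 : 10 ^ 7 * (F.L : ℝ) ^ 3 * (178 * (ε₀ + e)) ≤ 1)
    (U₀ : GaugeField (F.P K) 0 (Matrix.specialUnitaryGroup (Fin 2) ℂ)) (hreg : RegPr F n K ε₀ U₀)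
    {H : (PBond (F.P n) 0 → Matrix (Fin 2) (Fin 2) ℂ) →ₗ[ℂ] (PBond (F.P K) 0 → Matrix (Fin 2) (Fin 2) ℂ)} (hb : 0 ≤ b) (hHop : ∀ Y, ‖H Y‖ ≤ b * ‖Y‖)
    (hHR : ∀ Y : PBond (F.P n) 0 → Matrix (Fin 2) (Fin 2) ℂ, (∀ c, star (Y c) = -Y c ∧ (Y c).trace = 0) → ∀ b', star (H Y b') = -H Y b' ∧ (H Y b').trace = 0)
    (hq : 9 * (40 * (2 * (3 * (2 * e + 2700 * (F.L : ℝ) * ε₀))) / (e * eta F n K) ^ 2) * b * ε < 1) (hRε : 6 * ε ≤ e * eta F n K)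
    (h47 : Chart47T3twS F n K h (40 * (2 * (3 * (2 * e + 2700 * (F.L : ℝ) * ε₀))) / (e * eta F n K) ^ 2) ε U₀ H) (hQH : ∀ X, QTwS F n K h U₀ (H X) = X)
    (h45L : ∀ Y, IsLandauPrintS F n K h c₀ cB U₀ (H Y))
    {A' : PBond (F.P K) 0 → Matrix (Fin 2) (Fin 2) ℂ} (hA' : 2 * ‖A'‖ < ε) (hA'R : ∀ b', star (A' b') = -A' b' ∧ (A' b').trace = 0)
    {X : PBond (F.P K) 0 → Matrix (Fin 2) (Fin 2) ℂ} (hX : ∀ b, (X b).IsHermitian ∧ (X b).trace = 0)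
    (hAX : A' - H (Dfix (CmapTwS F n K h U₀) H (40 * (2 * (3 * (2 * e + 2700 * (F.L : ℝ) * ε₀))) / (e * eta F n K) ^ 2) A') = fun b' => Complex.I • X b')
    (hsize : nMax19 F n K U₀ X < e)
    (hLift : ∀ cf : Site (F.P K) (K - n) → Matrix (Fin 2) (Fin 2) ℂ,
      (∀ e' : PBond (F.P K) (K - n), cf e'.src = ((emlIterU (K - n) (bgUnits F K U₀) e' : (Matrix (Fin 2) (Fin 2) ℂ)ˣ) : Matrix (Fin 2) (Fin 2) ℂ) * cf e'.tgt *
        (((emlIterU (K - n) (bgUnits F K U₀) e')⁻¹ : (Matrix (Fin 2) (Fin 2) ℂ)ˣ) : Matrix (Fin 2) (Fin 2) ℂ)) →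
      ∃ l₀ : Site (F.P K) 0 → Matrix (Fin 2) (Fin 2) ℂ,
        (∀ b' : PBond (F.P K) 0, l₀ b'.src = ((bgUnits F K U₀ b' : (Matrix (Fin 2) (Fin 2) ℂ)ˣ) : Matrix (Fin 2) (Fin 2) ℂ) * l₀ b'.tgt * (((bgUnits F K U₀ b')⁻¹ : (Matrix (Fin 2) (Fin 2) ℂ)ˣ) : Matrix (Fin 2) (Fin 2) ℂ)) ∧
        ∀ y : Site (F.P K) (K - n), l₀ (embIter (K - n) y) = cf y)
    {Y : Type*} [AddCommGroup Y] (Kop : (Site (F.P K) 0 → Matrix (Fin 2) (Fin 2) ℂ) → Y) (q : Y → ℝ)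
    (hKsub : ∀ a b : Site (F.P K) 0 → Matrix (Fin 2) (Fin 2) ℂ, Kop (a - b) = Kop a - Kop b)
    {C₀ δ : ℝ} (hC₀ : 0 ≤ C₀) (hδ : 0 ≤ δ)
    (hwin : 2 * (56 * e) * (2 + C₀ * δ * (2 * 2)) + C₀ * δ * (2 * 2) < 1)
    (hT : ∀ (N' : Site (F.P K) 0 → Matrix (Fin 2) (Fin 2) ℂ) (w : PBond (F.P K) 0 → Matrix (Fin 2) (Fin 2) ℂ),
      (∀ b, gSer ℂ (ad ℂ (-(A' - H (Dfix (CmapTwS F n K h U₀) H (40 * (2 * (3 * (2 * e + 2700 * (F.L : ℝ) * ε₀))) / (e * eta F n K) ^ 2) A')) b)) (w b) =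
        N' b.src - exp ((A' - H (Dfix (CmapTwS F n K h U₀) H (40 * (2 * (3 * (2 * e + 2700 * (F.L : ℝ) * ε₀))) / (e * eta F n K) ^ 2) A')) b) * (((U₀ b : Matrix.specialUnitaryGroup (Fin 2) ℂ) : Matrix (Fin 2) (Fin 2) ℂ) * N' b.tgt
          * star ((U₀ b : Matrix.specialUnitaryGroup (Fin 2) ℂ) : Matrix (Fin 2) (Fin 2) ℂ)) * exp (-(A' - H (Dfix (CmapTwS F n K h U₀) H (40 * (2 * (3 * (2 * e + 2700 * (F.L : ℝ) * ε₀))) / (e * eta F n K) ^ 2) A')) b)) →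
      Kop N' = 0 → fderiv ℂ (logChartTwS F n K h U₀) (A' - H (Dfix (CmapTwS F n K h U₀) H (40 * (2 * (3 * (2 * e + 2700 * (F.L : ℝ) * ε₀))) / (e * eta F n K) ^ 2) A')) w = 0)
    (hQ4 : ∀ m : Y, ∃ N : Site (F.P K) 0 → Matrix (Fin 2) (Fin 2) ℂ, Kop N = m ∧ ‖toL2S F K c₀ N‖ ≤ C₀ * q m ∧
      ‖DL2 F n K c₀ U₀ (toL2S F K c₀ N)‖ ≤ C₀ * q m ∧ ‖covLapSite F n K c₀ U₀ (toL2S F K c₀ N)‖ ≤ C₀ * q m)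
    (hKT : ∀ l₁ : Site (F.P K) 0 → Matrix (Fin 2) (Fin 2) ℂ, toL2S F K c₀ l₁ ∈ NS F n K h c₀ cB U₀ →
      (∃ ns : (j : ℕ) → Site (F.P K) j → Matrix (Fin 2) (Fin 2) ℂ, ns 0 = l₁ ∧
        (∀ (j : ℕ) (y : Site (F.P K) (j + 1)), ns (j + 1) y = ns j (emb y) - meanCLM (Idx (F.P K)) (Matrix (Fin 2) (Fin 2) ℂ) fun i : Idx (F.P K) =>
          ns j (emb y) - ((holT (emlIterU j (bgUnits F K U₀)) (emb y) (stairWord i.2.1 (off i.1)) : (Matrix (Fin 2) (Fin 2) ℂ)ˣ) : Matrix (Fin 2) (Fin 2) ℂ) *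
            ns j (transl (emb y) (disp (stairWord i.2.1 (off i.1)))) * (((holT (emlIterU j (bgUnits F K U₀)) (emb y) (stairWord i.2.1 (off i.1)))⁻¹ : (Matrix (Fin 2) (Fin 2) ℂ)ˣ) : Matrix (Fin 2) (Fin 2) ℂ)) ∧
        ∀ y, ns (K - n) y = 0) →
      q (Kop l₁) ≤ δ * (‖toL2S F K c₀ l₁‖ + ‖DL2 F n K c₀ U₀ (toL2S F K c₀ l₁)‖)) :
    ∀ D : (PBond (F.P K) 0 → Matrix (Fin 2) (Fin 2) ℂ) →L[ℂ] (PBond (F.P K) 0 → Matrix (Fin 2) (Fin 2) ℂ),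
      HasFDerivAt (fun A : PBond (F.P K) 0 → Matrix (Fin 2) (Fin 2) ℂ =>
        A - H (Dfix (CmapTwS F n K h U₀) H (40 * (2 * (3 * (2 * e + 2700 * (F.L : ℝ) * ε₀))) / (e * eta F n K) ^ 2) A)) D A' →
      ∀ ξ : PBond (F.P K) 0 → Matrix (Fin 2) (Fin 2) ℂ, (∀ b', star (ξ b') = -ξ b' ∧ (ξ b').trace = 0) →
      QSym F n K h (emb15 U₀ (expHermField X)) ξ = 0 →
      ∃ δ' : PBond (F.P K) 0 → Matrix (Fin 2) (Fin 2) ℂ, (∀ b', star (δ' b') = -δ' b' ∧ (δ' b').trace = 0) ∧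
        (QTwS F n K h U₀ δ' = 0 ∧ IsLandauPrintS F n K h c₀ cB U₀ δ') ∧
        ∃ N : Site (F.P K) 0 → Matrix (Fin 2) (Fin 2) ℂ, (∀ x, (N x).IsHermitian ∧ (N x).trace = 0) ∧
          ∀ b' : PBond (F.P K) 0, ξ b' =
            gSer ℂ (ad ℂ (-(A' - H (Dfix (CmapTwS F n K h U₀) H (40 * (2 * (3 * (2 * e + 2700 * (F.L : ℝ) * ε₀))) / (e * eta F n K) ^ 2) A')) b'))
              ((D δ') b')
            + (Complex.I • N b'.src - ((emb15 U₀ (expHermField X) b' : Matrix.specialUnitaryGroup (Fin 2) ℂ) : Matrix (Fin 2) (Fin 2) ℂ) * (Complex.I • N b'.tgt)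
                * star ((emb15 U₀ (expHermField X) b' : Matrix.specialUnitaryGroup (Fin 2) ℂ) : Matrix (Fin 2) (Fin 2) ℂ)) := by
  have hL1 : (1 : ℝ) ≤ (F.L : ℝ) := by exact_mod_cast F.hL.2.le
  have hL3 : (1 : ℝ) ≤ (F.L : ℝ) ^ 3 := one_le_pow₀ hL1
  have hε7 : 10 ^ 7 * (F.L : ℝ) ^ 3 * ε₀ ≤ 1 := by nlinarith
  have h1 : (1 : ℝ) ≤ 2 := by norm_num
  exact hSplitD_of_rows F h hε₀ he hWe hWε hw137 U₀ hreg hb hHop hHR hq hRε h47 hQH h45L hA' hA'R hX hAX hsize _ Kop q hKsub (P₂ := 2) hC₀ hδ h1 hwin hT hQ4 hKT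
    (hPoinc_of_regPr F h cB hε₀ hε7 U₀ hreg) (hHZ_of_parallelLift F h hε₀ hWε U₀ hreg hLift)

end Summit.QuantumFields.YangMills.Theorems.Prop7HSplitDOfThreeRows

end
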